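import Mathlib
import Literature.Analysis.FunctionSpaces.WeakDerivInner
import Literature.Analysis.FluidPDE.CKNMorreyQuadraticMean
import Literature.Analysis.FluidPDE.DivCurlAnnihilator
import Literature.Analysis.FluidPDE.WeakGradientIBP
import HarnessLib

/-!
# Crux `EulerZoomLiouville.PowerGaugeEulerLiouville` (stmt-NavierStokesRegularity-19832), stub `stub_nonSelfSimilarRest`:
# THE WEAK LAMB IDENTITY `∫⟪V, Dη[V]⟫ = −∫⟪η, DV[V]⟫ − ∫⟪η, V⟫ tr DV` for `V ∈ W^{1,2}_loc(ℝ³; ℝ³)`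

Helper file (theorems only; `--supports stmt-NavierStokesRegularity-19832`; def-free; pure analysis).  Hand leafhand-ns-eulerzoomliouville-10 g3.
Connects the velocity-tested weak Lamb curl of hand g1's convention (`∫⟪V, Dη[V]⟫`, `η` a curl pair) with the pointwise Lamb vector `(G − Gᵀ)V`
of a field `V` with weak gradient `G`, `V, G ∈ L²_loc`: the weak product rule (`HasWeakFDerivOn.inner`, [Evans2010 §5.2.3]) for the products
`VᵢVⱼ` on a ball containing the support of the test field.

* `LambIdentity.integral_fderiv_mul_comp_eq` — one pair of components: `∫ (∂_c φ) ⟪V,a⟫⟪V,c⟫ = −∫ φ (⟪V,c⟫⟪a, G c⟫ + ⟪V,a⟫⟪c, G c⟫)`;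
* `LambIdentity.integral_inner_fderiv_apply_self_eq` — THE WEAK LAMB IDENTITY `∫⟪V, Dη[V]⟫ = −∫ (⟪η, G V⟫ + ⟪V, η⟫ tr G)` for every vector test
  field `η` (so for a divergence-free `V` with Lamb vector `(G − Gᵀ)V = 0` a.e. and `div η = 0`, the velocity-tested weak Lamb curl of hand g1's
  convention reduces to `−∫⟪V, G η⟫ = ½∫ (div η)|V|² = 0` — the intended use, «pointwise Beltrami past ⇒ `Birth.nonSelfSimilar_of_weakLambCurlFreePast`»,
  is left to the sequel).

WHAT THIS IS NOT: nothing about Euler or Navier–Stokes by itself. [folklore; Evans2010 §5.2.3 Thm. 1 (iv)]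
-/

noncomputable section

-- flat `Theorems/<Route><Decl>…` files of one crux share the namespace of the crux (tree convention)
set_option linter.dupNamespace false

open MeasureTheory Set Filter Topology Metric Function TopologicalSpace
open scoped RealInnerProductSpace NNReal ENNReal ContDiff

namespace Summit.NavierStokesRegularity.NavierStokesRegularity.Theorems.PowerGaugeEulerLiouville

open Literature.Analysis Literature.Analysis.FunctionSpaces Literature.Analysis.FluidPDE

namespace LambIdentity

variable {V : EuclideanSpace ℝ (Fin 3) → EuclideanSpace ℝ (Fin 3)}
  {G : EuclideanSpace ℝ (Fin 3) → EuclideanSpace ℝ (Fin 3) →L[ℝ] EuclideanSpace ℝ (Fin 3)}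

/-- **One pair of components of the weak product rule**: for `V` with whole-space weak gradient `G`, `V, G ∈ L²_loc`, a scalar test function `φ`
and vectors `a, c`: `∫ (∂_c φ) ⟪V,a⟫⟪V,c⟫ = −∫ φ (⟪V,c⟫⟪a, G c⟫ + ⟪V,a⟫⟪c, G c⟫)`. [folklore; Evans2010 §5.2.3 Thm. 1 (iv)] -/
theorem integral_fderiv_mul_comp_eq (hG : HasWeakFDerivOn (⊤ : Opens (EuclideanSpace ℝ (Fin 3))) volume V G)
    (hV2 : LocallyIntegrable (fun x => ‖V x‖ ^ 2) volume)
    (hG2 : LocallyIntegrable (fun x => ‖G x‖ ^ 2) volume)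
    {φ : EuclideanSpace ℝ (Fin 3) → ℝ} (hφ : IsTestFunctionOn (⊤ : Opens (EuclideanSpace ℝ (Fin 3))) φ) (a c : EuclideanSpace ℝ (Fin 3)) :
    ∫ x, fderiv ℝ φ x c * (⟪V x, a⟫ * ⟪V x, c⟫) = -∫ x, φ x * (⟪V x, c⟫ * ⟪a, G x c⟫ + ⟪V x, a⟫ * ⟪c, G x c⟫) := by
  -- a ball containing the support of `φ`
  obtain ⟨R, hR⟩ := (hφ.hasCompactSupport.isCompact).isBounded.subset_closedBall (0 : EuclideanSpace ℝ (Fin 3))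
  set Ω : Opens (EuclideanSpace ℝ (Fin 3)) := ⟨ball 0 (R + 1), isOpen_ball⟩ with hΩ
  have hφΩ : tsupport φ ⊆ (Ω : Set (EuclideanSpace ℝ (Fin 3))) :=
    hR.trans (closedBall_subset_ball (by linarith))
  have hφ' : IsTestFunctionOn Ω φ := ⟨hφ.contDiff, hφ.hasCompactSupport, hφΩ⟩
  have hGΩ : HasWeakFDerivOn Ω volume V G := HasWeakFDerivOn.mono_set_holds hG le_top
  -- `L²` facts on the ball
  have hKc : IsCompact (closedBall (0 : EuclideanSpace ℝ (Fin 3)) (R + 1)) := isCompact_closedBall _ _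
  have hsub : (Ω : Set (EuclideanSpace ℝ (Fin 3))) ⊆ closedBall 0 (R + 1) := ball_subset_closedBall
  have hVm : AEStronglyMeasurable V (volume.restrict (Ω : Set (EuclideanSpace ℝ (Fin 3)))) :=
    hGΩ.locallyIntegrableOn.aestronglyMeasurable
  have hGm : AEStronglyMeasurable G (volume.restrict (Ω : Set (EuclideanSpace ℝ (Fin 3)))) :=
    hGΩ.locallyIntegrableOn_deriv.aestronglyMeasurable
  have hVL2 : MemLp V 2 (volume.restrict (Ω : Set (EuclideanSpace ℝ (Fin 3)))) :=
    (memLp_two_iff_integrable_sq_norm hVm).2 ((hV2.integrableOn_isCompact hKc).mono_set hsub)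
  have hGL2 : MemLp G 2 (volume.restrict (Ω : Set (EuclideanSpace ℝ (Fin 3)))) :=
    (memLp_two_iff_integrable_sq_norm hGm).2 ((hG2.integrableOn_isCompact hKc).mono_set hsub)
  have hcomp : ∀ v : EuclideanSpace ℝ (Fin 3), MemLp (fun x => ⟪V x, v⟫) 2 (volume.restrict (Ω : Set (EuclideanSpace ℝ (Fin 3)))) := by
    intro v
    refine MemLp.of_le_mul hVL2 (hVm.inner aestronglyMeasurable_const) (c := ‖v‖) (Eventually.of_forall fun x => ?_)
    rw [mul_comm]; exact norm_inner_le_norm _ _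
  have hGcomp : ∀ v w : EuclideanSpace ℝ (Fin 3), MemLp (fun x => ((innerSL ℝ v).comp (G x)) w) 2
      (volume.restrict (Ω : Set (EuclideanSpace ℝ (Fin 3)))) := by
    intro v w
    have hm : AEStronglyMeasurable (fun x => ((innerSL ℝ v).comp (G x)) w) (volume.restrict (Ω : Set (EuclideanSpace ℝ (Fin 3)))) := by
      have h1 : AEStronglyMeasurable (fun x => G x w) (volume.restrict (Ω : Set (EuclideanSpace ℝ (Fin 3)))) :=
        (ContinuousLinearMap.apply ℝ (EuclideanSpace ℝ (Fin 3)) w).continuous.comp_aestronglyMeasurable hGm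
      simpa only [ContinuousLinearMap.comp_apply, innerSL_apply_apply] using (aestronglyMeasurable_const.inner h1)
    refine MemLp.of_le_mul hGL2 hm (c := ‖v‖ * ‖w‖) (Eventually.of_forall fun x => ?_)
    simp only [ContinuousLinearMap.comp_apply, innerSL_apply_apply]
    calc ‖⟪v, G x w⟫‖ ≤ ‖v‖ * ‖G x w‖ := norm_inner_le_norm _ _
      _ ≤ ‖v‖ * (‖G x‖ * ‖w‖) := mul_le_mul_of_nonneg_left (ContinuousLinearMap.le_opNorm _ _) (norm_nonneg _)
      _ = ‖v‖ * ‖w‖ * ‖G x‖ := by ring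
  -- the product rule for `⟪V,a⟫ ⟪V,c⟫`
  have hca := hGΩ.inner_const a
  have hcc := hGΩ.inner_const c
  have hprod := HasWeakFDerivOn.inner (F := ℝ) (hcomp a) (hcomp c) hca hcc (hGcomp a) (hGcomp c)
  have key := hprod.integral_fderiv_smul_eq φ c hφ'
  -- the set integrals are whole-space integrals
  have h1 : ∀ x, x ∉ (Ω : Set (EuclideanSpace ℝ (Fin 3))) →
      fderiv ℝ φ x c • (⟪⟪V x, a⟫, ⟪V x, c⟫⟫) = 0 := fun x hx => by
    simp [fderiv_of_notMem_tsupport (𝕜 := ℝ) (fun h => hx (hφΩ h))]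
  have h2 : ∀ x, x ∉ (Ω : Set (EuclideanSpace ℝ (Fin 3))) →
      φ x • (((innerSL ℝ ⟪V x, c⟫).comp ((innerSL ℝ a).comp (G x)) + (innerSL ℝ ⟪V x, a⟫).comp ((innerSL ℝ c).comp (G x))) c) = 0 :=
    fun x hx => by simp [image_eq_zero_of_notMem_tsupport (fun h => hx (hφΩ h))]
  rw [setIntegral_eq_integral_of_forall_compl_eq_zero h1, setIntegral_eq_integral_of_forall_compl_eq_zero h2] at key
  have e1 : (fun x => fderiv ℝ φ x c • (⟪⟪V x, a⟫, ⟪V x, c⟫⟫)) = fun x => fderiv ℝ φ x c * (⟪V x, a⟫ * ⟪V x, c⟫) := by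
    funext x
    simp only [smul_eq_mul, Real.inner_apply]
  have e2 : (fun x => φ x • (((innerSL ℝ ⟪V x, c⟫).comp ((innerSL ℝ a).comp (G x)) +
      (innerSL ℝ ⟪V x, a⟫).comp ((innerSL ℝ c).comp (G x))) c)) =
      fun x => φ x * (⟪V x, c⟫ * ⟪a, G x c⟫ + ⟪V x, a⟫ * ⟪c, G x c⟫) := by
    funext x
    simp only [smul_eq_mul, add_apply, ContinuousLinearMap.comp_apply, innerSL_apply_apply, Real.inner_apply]
  rw [e1, e2] at key
  exact key

/-- Integrability of `ψ · ⟪V,a⟫ · g` on `ℝ³` for `ψ` continuous with support in a ball on which `⟪V,a⟫, g ∈ L²`. [folklore] -/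
theorem integrable_mul_mul_of_memLp {Ω : Set (EuclideanSpace ℝ (Fin 3))} {f g : EuclideanSpace ℝ (Fin 3) → ℝ}
    (hf : MemLp f 2 (volume.restrict Ω)) (hg : MemLp g 2 (volume.restrict Ω))
    {ψ : EuclideanSpace ℝ (Fin 3) → ℝ} (hψ : Continuous ψ) (hψc : HasCompactSupport ψ) (hψΩ : tsupport ψ ⊆ Ω) :
    Integrable (fun x => ψ x * (f x * g x)) volume := by
  obtain ⟨M, hM⟩ := hψ.bounded_above_of_compact_support hψc
  have h1 : Integrable (f * g) (volume.restrict Ω) := MemLp.integrable_mul hf hg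
  have h2 : Integrable (fun x => ψ x * (f * g) x) (volume.restrict Ω) :=
    h1.bdd_mul hψ.aestronglyMeasurable (Eventually.of_forall hM)
  refine (integrableOn_iff_integrable_of_support_subset ?_).1 h2
  intro x hx
  by_contra hxΩ
  exact hx (by simp [image_eq_zero_of_notMem_tsupport (fun h => hxΩ (hψΩ h))])

/-- **THE WEAK LAMB IDENTITY** `∫⟪V, Dη[V]⟫ = −∫ (⟪η, G V⟫ + ⟪V, η⟫ tr G)` for `V` with whole-space weak gradient `G`, `V, G ∈ L²_loc`, and a vector test field
`η` (the weak product rule summed over components; `(G V)ᵢ = Σⱼ Vⱼ ∂ⱼVᵢ = ((V·∇)V)ᵢ`, `tr G = div V`).  For a divergence-free `V` the last term drops.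
[folklore; Evans2010 §5.2.3 Thm. 1 (iv)] -/
theorem integral_inner_fderiv_apply_self_eq (hG : HasWeakFDerivOn (⊤ : Opens (EuclideanSpace ℝ (Fin 3))) volume V G)
    (hV2 : LocallyIntegrable (fun x => ‖V x‖ ^ 2) volume)
    (hG2 : LocallyIntegrable (fun x => ‖G x‖ ^ 2) volume)
    {η : EuclideanSpace ℝ (Fin 3) → EuclideanSpace ℝ (Fin 3)} (hη : IsTestFunctionOn (⊤ : Opens (EuclideanSpace ℝ (Fin 3))) η) :
    ∫ x, ⟪V x, fderiv ℝ η x (V x)⟫ =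
      -∫ x, (⟪η x, G x (V x)⟫ + ⟪V x, η x⟫ * ∑ j, ⟪(EuclideanSpace.basisFun (Fin 3) ℝ) j, G x ((EuclideanSpace.basisFun (Fin 3) ℝ) j)⟫) := by
  set b : OrthonormalBasis (Fin 3) ℝ (EuclideanSpace ℝ (Fin 3)) := EuclideanSpace.basisFun (Fin 3) ℝ with hb
  have hηd : Differentiable ℝ η := hη.contDiff.differentiable (by simp)
  -- the scalar tests `φᵢ = ⟪bᵢ, η⟫` and their derivatives
  have hφ : ∀ i, IsTestFunctionOn (⊤ : Opens (EuclideanSpace ℝ (Fin 3))) (fun x => ⟪b i, η x⟫) := fun i =>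
    ⟨contDiff_const.inner ℝ hη.contDiff, hη.hasCompactSupport.mono (fun x hx => by
      intro h0; exact hx (by simp [h0])), by simp⟩
  have hφd : ∀ i x v, fderiv ℝ (fun x => ⟪b i, η x⟫) x v = ⟪b i, fderiv ℝ η x v⟫ := by
    intro i x v
    have h := ((innerSL ℝ (b i)).hasFDerivAt.comp x (hηd x).hasFDerivAt).fderiv
    have e : (fun x => ⟪b i, η x⟫) = (innerSL ℝ (b i)) ∘ η := by funext x; simp
    rw [e, h]
    simp [innerSL_apply_apply]
  -- one pair of components
  have hpair : ∀ i j, ∫ x, ⟪b i, fderiv ℝ η x (b j)⟫ * (⟪V x, b i⟫ * ⟪V x, b j⟫) =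
      -∫ x, ⟪b i, η x⟫ * (⟪V x, b j⟫ * ⟪b i, G x (b j)⟫ + ⟪V x, b i⟫ * ⟪b j, G x (b j)⟫) := by
    intro i j
    have h := integral_fderiv_mul_comp_eq hG hV2 hG2 (hφ i) (b i) (b j)
    simp_rw [hφd] at h
    exact h
  -- integrability of every summand (on a ball containing the support of `η`)
  obtain ⟨R, hR⟩ := (hη.hasCompactSupport.isCompact).isBounded.subset_closedBall (0 : EuclideanSpace ℝ (Fin 3))
  set Ω : Set (EuclideanSpace ℝ (Fin 3)) := ball 0 (R + 1) with hΩ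
  have hηΩ : tsupport η ⊆ Ω := hR.trans (closedBall_subset_ball (by linarith))
  have hGΩ : HasWeakFDerivOn (⟨Ω, isOpen_ball⟩ : Opens (EuclideanSpace ℝ (Fin 3))) volume V G :=
    HasWeakFDerivOn.mono_set_holds hG le_top
  have hKc : IsCompact (closedBall (0 : EuclideanSpace ℝ (Fin 3)) (R + 1)) := isCompact_closedBall _ _
  have hsub : Ω ⊆ closedBall 0 (R + 1) := ball_subset_closedBall
  have hVm : AEStronglyMeasurable V (volume.restrict Ω) := hGΩ.locallyIntegrableOn.aestronglyMeasurable
  have hGm : AEStronglyMeasurable G (volume.restrict Ω) := hGΩ.locallyIntegrableOn_deriv.aestronglyMeasurable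
  have hVL2 : MemLp V 2 (volume.restrict Ω) :=
    (memLp_two_iff_integrable_sq_norm hVm).2 ((hV2.integrableOn_isCompact hKc).mono_set hsub)
  have hGL2 : MemLp G 2 (volume.restrict Ω) :=
    (memLp_two_iff_integrable_sq_norm hGm).2 ((hG2.integrableOn_isCompact hKc).mono_set hsub)
  have hcomp : ∀ v : EuclideanSpace ℝ (Fin 3), MemLp (fun x => ⟪V x, v⟫) 2 (volume.restrict Ω) := by
    intro v
    refine MemLp.of_le_mul hVL2 (hVm.inner aestronglyMeasurable_const) (c := ‖v‖) (Eventually.of_forall fun x => ?_)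
    rw [mul_comm]; exact norm_inner_le_norm _ _
  have hGcomp : ∀ v w : EuclideanSpace ℝ (Fin 3), MemLp (fun x => ⟪v, G x w⟫) 2 (volume.restrict Ω) := by
    intro v w
    have h1 : AEStronglyMeasurable (fun x => G x w) (volume.restrict Ω) :=
      (ContinuousLinearMap.apply ℝ (EuclideanSpace ℝ (Fin 3)) w).continuous.comp_aestronglyMeasurable hGm
    refine MemLp.of_le_mul hGL2 (aestronglyMeasurable_const.inner h1) (c := ‖v‖ * ‖w‖) (Eventually.of_forall fun x => ?_)
    calc ‖⟪v, G x w⟫‖ ≤ ‖v‖ * ‖G x w‖ := norm_inner_le_norm _ _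
      _ ≤ ‖v‖ * (‖G x‖ * ‖w‖) := mul_le_mul_of_nonneg_left (ContinuousLinearMap.le_opNorm _ _) (norm_nonneg _)
      _ = ‖v‖ * ‖w‖ * ‖G x‖ := by ring
  -- supports
  have hψ1 : ∀ i j, Continuous (fun x => ⟪b i, fderiv ℝ η x (b j)⟫) := fun i j =>
    continuous_const.inner ((hη.contDiff.continuous_fderiv (by simp)).clm_apply continuous_const)
  have hψ1c : ∀ i j, HasCompactSupport (fun x => ⟪b i, fderiv ℝ η x (b j)⟫) := fun i j =>
    (hη.hasCompactSupport.fderiv_apply (𝕜 := ℝ) (b j)).mono (fun x hx => by intro h0; exact hx (by simp [h0]))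
  have hψ1Ω : ∀ i j, tsupport (fun x => ⟪b i, fderiv ℝ η x (b j)⟫) ⊆ Ω := by
    intro i j
    have hs : support (fun x => ⟪b i, fderiv ℝ η x (b j)⟫) ⊆ tsupport η := fun x hx => by
      by_contra h0
      exact hx (by simp [fderiv_of_notMem_tsupport (𝕜 := ℝ) h0])
    exact (closure_minimal hs (isClosed_tsupport η)).trans hηΩ
  have hψ2 : ∀ i, Continuous (fun x => ⟪b i, η x⟫) := fun i => continuous_const.inner hη.contDiff.continuous
  have hψ2c : ∀ i, HasCompactSupport (fun x => ⟪b i, η x⟫) := fun i => (hφ i).hasCompactSupport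
  have hψ2Ω : ∀ i, tsupport (fun x => ⟪b i, η x⟫) ⊆ Ω := by
    intro i
    have hs : support (fun x => ⟪b i, η x⟫) ⊆ tsupport η := fun x hx => by
      by_contra h0
      exact hx (by simp [image_eq_zero_of_notMem_tsupport h0])
    exact (closure_minimal hs (isClosed_tsupport η)).trans hηΩ
  -- integrable summands
  have iL : ∀ i j, Integrable (fun x => ⟪b i, fderiv ℝ η x (b j)⟫ * (⟪V x, b i⟫ * ⟪V x, b j⟫)) volume := fun i j =>
    integrable_mul_mul_of_memLp (hcomp (b i)) (hcomp (b j)) (hψ1 i j) (hψ1c i j) (hψ1Ω i j)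
  have iR1 : ∀ i j, Integrable (fun x => ⟪b i, η x⟫ * (⟪V x, b j⟫ * ⟪b i, G x (b j)⟫)) volume := fun i j =>
    integrable_mul_mul_of_memLp (hcomp (b j)) (hGcomp (b i) (b j)) (hψ2 i) (hψ2c i) (hψ2Ω i)
  have iR2 : ∀ i j, Integrable (fun x => ⟪b i, η x⟫ * (⟪V x, b i⟫ * ⟪b j, G x (b j)⟫)) volume := fun i j =>
    integrable_mul_mul_of_memLp (hcomp (b i)) (hGcomp (b j) (b j)) (hψ2 i) (hψ2c i) (hψ2Ω i)
  have iR : ∀ i j, Integrable (fun x => ⟪b i, η x⟫ * (⟪V x, b j⟫ * ⟪b i, G x (b j)⟫ + ⟪V x, b i⟫ * ⟪b j, G x (b j)⟫)) volume := by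
    intro i j
    refine ((iR1 i j).add (iR2 i j)).congr (Eventually.of_forall fun x => ?_)
    simp only [Pi.add_apply]
    ring
  -- expansions along the basis
  have hV : ∀ x, ∑ j, ⟪V x, b j⟫ • b j = V x := fun x => by
    conv_rhs => rw [← b.sum_repr' (V x)]
    exact Finset.sum_congr rfl fun j _ => by rw [real_inner_comm]
  have hDV : ∀ x, fderiv ℝ η x (V x) = ∑ j, ⟪V x, b j⟫ • fderiv ℝ η x (b j) := fun x => by
    conv_lhs => rw [← hV x]
    rw [map_sum]
    exact Finset.sum_congr rfl fun j _ => by rw [map_smul]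
  have hGV : ∀ x, G x (V x) = ∑ j, ⟪V x, b j⟫ • G x (b j) := fun x => by
    conv_lhs => rw [← hV x]
    rw [map_sum]
    exact Finset.sum_congr rfl fun j _ => by rw [map_smul]
  -- pointwise identities
  have hL : ∀ x, ⟪V x, fderiv ℝ η x (V x)⟫ = ∑ i, ∑ j, ⟪b i, fderiv ℝ η x (b j)⟫ * (⟪V x, b i⟫ * ⟪V x, b j⟫) := by
    intro x
    rw [Finset.sum_comm]
    rw [hDV x, inner_sum]
    refine Finset.sum_congr rfl fun j _ => ?_
    rw [inner_smul_right, ← b.sum_inner_mul_inner (V x) (fderiv ℝ η x (b j)), Finset.mul_sum]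
    refine Finset.sum_congr rfl fun i _ => ?_
    ring
  have hR : ∀ x, ∑ i, ∑ j, ⟪b i, η x⟫ * (⟪V x, b j⟫ * ⟪b i, G x (b j)⟫ + ⟪V x, b i⟫ * ⟪b j, G x (b j)⟫) =
      ⟪η x, G x (V x)⟫ + ⟪V x, η x⟫ * ∑ j, ⟪b j, G x (b j)⟫ := by
    intro x
    have h1 : ⟪η x, G x (V x)⟫ = ∑ i, ∑ j, ⟪b i, η x⟫ * (⟪V x, b j⟫ * ⟪b i, G x (b j)⟫) := by
      rw [← b.sum_inner_mul_inner (η x) (G x (V x))]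
      refine Finset.sum_congr rfl fun i _ => ?_
      rw [hGV x, inner_sum, Finset.mul_sum]
      refine Finset.sum_congr rfl fun j _ => ?_
      rw [inner_smul_right, real_inner_comm (b i) (η x), mul_left_comm]
    have h2 : ⟪V x, η x⟫ * ∑ j, ⟪b j, G x (b j)⟫ = ∑ i, ∑ j, ⟪b i, η x⟫ * (⟪V x, b i⟫ * ⟪b j, G x (b j)⟫) := by
      rw [← b.sum_inner_mul_inner (V x) (η x), Finset.sum_mul]
      refine Finset.sum_congr rfl fun i _ => ?_
      rw [Finset.mul_sum]
      refine Finset.sum_congr rfl fun j _ => ?_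
      ring
    rw [h1, h2, ← Finset.sum_add_distrib]
    refine Finset.sum_congr rfl fun i _ => ?_
    rw [← Finset.sum_add_distrib]
    refine Finset.sum_congr rfl fun j _ => ?_
    ring
  -- assemble
  simp_rw [hL]
  rw [integral_finsetSum _ fun i _ => integrable_finsetSum _ fun j _ => iL i j]
  have e3 : ∀ i, ∫ x, ∑ j, ⟪b i, fderiv ℝ η x (b j)⟫ * (⟪V x, b i⟫ * ⟪V x, b j⟫) =
      -∫ x, ∑ j, ⟪b i, η x⟫ * (⟪V x, b j⟫ * ⟪b i, G x (b j)⟫ + ⟪V x, b i⟫ * ⟪b j, G x (b j)⟫) := by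
    intro i
    rw [integral_finsetSum _ fun j _ => iL i j, integral_finsetSum _ fun j _ => iR i j, ← Finset.sum_neg_distrib]
    exact Finset.sum_congr rfl fun j _ => hpair i j
  simp_rw [e3]
  rw [Finset.sum_neg_distrib, ← integral_finsetSum _ fun i _ => integrable_finsetSum _ fun j _ => iR i j]
  congr 1
  exact integral_congr_ae (Eventually.of_forall fun x => hR x)

end LambIdentity

end Summit.NavierStokesRegularity.NavierStokesRegularity.Theorems.PowerGaugeEulerLiouville

end
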